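import Mathlib
import Literature.AlgebraicGeometry.Resolution.SyzygySheaf
import HarnessLib

/-!
# `SyzygyFlattening.HigherRankTermination`, line `birth`: the generalised Schanuel lemma

Route `ResolutionOfSingularities/SyzygyFlattening`, crux `HigherRankTermination`
(stmt-ResolutionOfSingularities-17045), stub `stub_syzygy_schanuel` of the lead's skeleton,
PROVED here (statement verbatim from the ledger registration).

**Statement (Matsumura, *Commutative ring theory*, §19 Lemma 4; Bruns–Herzog §1.3).** Two
resolutions `⋯ → R^{b 1} —d 0→ R^{b 0} —ε→ P → 0` and `⋯ → R^{b' 1} —d' 0→ R^{b' 0} —ε'→ P → 0`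
of the same `R`-module `P` by finite free modules have STABLY ISOMORPHIC syzygy modules at every
stage: for every `n` there are `a a' : ℕ` with
`range (d n) × Rᵃ ≃ₗ[R] range (d' n) × R^{a'}`.

**Proof.** The data `(b, d, ε)` with the three exactness conditions is literally a
`Literature.AlgebraicGeometry.Resolution.FreeResolution R P` (free resolution of finite type in
coordinates), whose `n`-th syzygy module `F.syzygy n` is `LinearMap.range (d n)` by `rfl`; the
claim is then `FreeResolution.syzygy_stablyEquiv` (generalised Schanuel: Schanuel's lemma for
`n = 0`, and inductively Schanuel applied to the presentations `R^{b (n+1)} ⊕ Rᵃ ↠ Ωₙ ⊕ Rᵃ`,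
`R^{b' (n+1)} ⊕ R^{a'} ↠ Ω'ₙ ⊕ R^{a'}` of the common module `Ωₙ ⊕ Rᵃ ≃ Ω'ₙ ⊕ R^{a'}`).
-/

noncomputable section

set_option linter.dupNamespace false

namespace Summit.ResolutionOfSingularities.ResolutionOfSingularities.Theorems.SyzygyFlattening

/-- **Generalised Schanuel lemma** (Matsumura §19 Lemma 4): two resolutions
`⋯ → R^{b 1} → R^{b 0} → P → 0` and `⋯ → R^{b' 1} → R^{b' 0} → P → 0` of the same module by
finite free modules have STABLY ISOMORPHIC syzygy modules at every stage:
`range (d n) × Rᵃ ≃ range (d' n) × R^{a'}` for some `a, a'`. Direct from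
`Literature.AlgebraicGeometry.Resolution.FreeResolution.syzygy_stablyEquiv` applied to the two
free resolutions of finite type `⟨b, d, ε, _, _, _⟩` and `⟨b', d', ε', _, _, _⟩` of `P`.
[cite: Matsumura1987, §19 Lemma 4] -/
theorem stub_syzygy_schanuel : ∀ (R : Type) [CommRing R] (P : Type) [AddCommGroup P] [Module R P]
    (b b' : ℕ → ℕ) (d : (i : ℕ) → ((Fin (b (i + 1)) → R) →ₗ[R] (Fin (b i) → R)))
    (ε : (Fin (b 0) → R) →ₗ[R] P)
    (d' : (i : ℕ) → ((Fin (b' (i + 1)) → R) →ₗ[R] (Fin (b' i) → R)))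
    (ε' : (Fin (b' 0) → R) →ₗ[R] P),
    Function.Surjective ε → Function.Exact (d 0) ε → (∀ i : ℕ, Function.Exact (d (i + 1)) (d i)) →
    Function.Surjective ε' → Function.Exact (d' 0) ε' →
    (∀ i : ℕ, Function.Exact (d' (i + 1)) (d' i)) →
    ∀ n : ℕ, ∃ a a' : ℕ,
      Nonempty ((↥(LinearMap.range (d n)) × (Fin a → R)) ≃ₗ[R]
        (↥(LinearMap.range (d' n)) × (Fin a' → R))) := by
  intro R _ P _ _ b b' d ε d' ε' hε h₀ hs hε' h₀' hs' n
  exact Literature.AlgebraicGeometry.Resolution.FreeResolution.syzygy_stablyEquiv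
    ⟨b, d, ε, hε, h₀, hs⟩ ⟨b', d', ε', hε', h₀', hs'⟩ n

end Summit.ResolutionOfSingularities.ResolutionOfSingularities.Theorems.SyzygyFlattening

end
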